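import Summits.BirchSwinnertonDyer.BirchSwinnertonDyer.Theorems.ByReductionTypeAtTwoAdditivePotMultConjATwoCubicModelTransport
import Literature.NumberTheory.EllipticCurves.Rank1Residual.Predicates
import Summits.BirchSwinnertonDyer.BirchSwinnertonDyer.Theorems.ByReductionTypeAtTwoOrdKatoHalfAtTwoIsoConjATwoOfPointFieldMu
import Summits.BirchSwinnertonDyer.BirchSwinnertonDyer.Theorems.AlignedTransportAtTwoMainConjectureOfRankZeroBSDAtTwoTorsionPointFieldDegree
import Literature.NumberTheory.IwasawaTheory.ClassicalMuVanishesAdjoinIOfNarrow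
import HarnessLib

/-!
# C4″ `AdditivePotMultOverKAtTwo` (item stmt-BirchSwinnertonDyer-22618), the «irreducible Kato 12.10» input (I1M′) of the upper half:
# the point field of a `2`-torsion point IS the cubic field `ℚ(x(T))` for EVERY Weierstrass model, two SIGN-FREE general-model doors
# ((A)₂ ⟸ `μ₂ = 0` of the sextic `ℚ(x(T), √−1)`; (A)₂ ⟸ NARROW `μ₂ = 0` of the cubic `ℚ(x(T))`), and the `0 < Δ` half of v11's binder
# `hAnaMI` re-keyed — so that the WHOLE binder is a statement about the `2`-division cubic field

Cell `bsd-2adic`, seat `bsd-2adic-k4-w3` GEN 10 (explicit unit (309)(7); `--supports 22618`; sequel of GEN 9's `…ConjATwoCubicFieldDoor`).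
HONEST FRAMING (D-0036/D-0054): THEOREMS ONLY — no definition, no named fact, no `sorry`; closes nothing at the `∀`-level; nothing booked;
BSD is not proved by any of this. Iwasawa's `μ₂ = 0` (plain or narrow) for the non-abelian cubic / sextic fields below is OPEN in general
(Iwasawa 1973; for the totally real cubics of the `0 < Δ` half it is Greenberg-conjecture territory); nothing is asserted about it.

WHY. GEN 9 split v11's research binder (I1M′) `hAnaMI` (Coates–Sujatha's statement (A) at `(W, 2)` on the irreducible, non-abelian-`ℚ(E[2])`
additive potentially multiplicative curves; 350 classes) by the sign of `Δ` and re-keyed the `Δ < 0` half (269 classes) to «`μ₂ = 0` for the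
cyclotomic `ℤ₂`-extension of the cubic field `ℚ(x(T))`» (`hAnaMI_of_cubicFieldMu_of_posDisc hμ3 hPos`), leaving the `0 < Δ` half (81 classes,
`ℚ(E[2])` totally real) DISPLAYED as `hPos`. Its model-change brick went through `W[2] ≅ W′[2]` and Lim–Sujatha at `Δ < 0`, because the tree's
identification «point field `ℚ̄^{Stab P}` = cubic field `ℚ(β)`» existed only for the cubic models `y² = x³ + px² + qx + r`
(`AddKatoTwo.fixedField_stabilizer_eq_adjoin_root`). §1 proves that identification for EVERY elliptic curve over any field of characteristic
`0` (general `a₁, a₃`; Mathlib's `2`-division cubic `4x³ + b₂x² + 2b₄x + b₆`), from the Dokchitser–Dokchitser letters `T₀, T₁, T₂` /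
abscissae `x(Tᵢ)` of `Literature/…/TwoTorsionGaloisActionProofs`: `Stab(Tᵢ) = Stab(x(Tᵢ))`. With it the cell's two KERNEL point-field doors
— w2 GEN 6's sextic door (p718233, carrier `ℚ(P, √−1)`, ANY sign of `Δ`) and w2 GEN 8's Kida-lite narrow ascent (Literature
`classicalMu_sup_adjoin_of_sq_eq_neg_one_of_narrowDefect_le`, p734295) — apply to general models in the `β = x(T)` currency with NO model
change and NO sign condition (§2), and the `0 < Δ` half of (I1M′) is re-keyed (§3).

* §1 (any field `K`, `2 ≠ 0` / `char 0`; `W/K` elliptic) `smul_T_eq_iff_smul_xT_eq`, `stabilizer_T_eq_stabilizer_xT`;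
  **`exists_geomTorsion_two_ne_zero_fixedField_stabilizer_eq_adjoin`**: for every root `β ∈ K̄` of the `2`-division cubic there is
  `P ∈ W[2] ∖ 0` with `Stab(P) = Stab(β)` and `K̄^{Stab P} = K⟮β⟯`; conversely `exists_root_fixedField_stabilizer_eq_adjoin`;
  `finrank_adjoin_root_twoTorsionPolynomial_eq_three` (`[K(β) : K] = 3` for irreducible `W[2]`).
* §2 (`K = ℚ`, general `W`, SIGN-FREE) **`conjA_two_of_classicalMu_cubicField_adjoin_I`**: `μ₂ = 0` along the cyclotomic `ℤ₂`-extensions of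
  `ℚ⟮β⟯ ⊔ ℚ⟮i⟯` (`i² = −1`) ⟹ (A)₂(W) (`∃ γ D` kernel form, every cyclotomic `κ`); **`conjA_two_of_narrowMu_cubicField`**: irreducible `W[2]`,
  (a) `μ₂ = 0` for every cyclotomic `ℤ₂`-extension of `ℚ⟮β⟯` and (b) bounded narrow defect `ord₂ h⁺ ≤ ord₂ h + D` along its layers ⟹ (A)₂(W).
* §3 the binder: **`hAnaMI_of_cubicFieldAdjoinIMu`** — v11's (I1M′) VERBATIM from ONE sign-free number-field statement «`μ₂ = 0` for the
  cyclotomic `ℤ₂`-extension of the sextic `ℚ(x(T), √−1)` of every irreducible pot-mult `W`»; `hAnaMI_of_cubicFieldNarrowMu` (VERBATIM from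
  narrow `μ₂(ℚ(x(T))) = 0`, sign-free); **`hAnaMI_posDisc_of_cubicFieldNarrowMu`** — GEN 9's displayed `hPos` (the `0 < Δ` half) from narrow
  `μ₂ = 0` of the TOTALLY REAL cubic `ℚ(x(T))` — so that with GEN 9's `hAnaMI_of_cubicFieldMu_of_posDisc` (I1M′) VERBATIM follows from
  H3M⁻ (`μ₂(ℚ(x(T))^cyc) = 0` on `Δ < 0`) ∧ H3M⁺ (narrow `μ₂(ℚ(x(T))^cyc) = 0` on `0 < Δ`): cubic-field data only (the one-line composition is
  filed in the sequel `…ConjATwoBinderSplit`, this file's import cone being kept free of `…ConjATwoCubicFieldDoor`). No restate of 19098 /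
  22618 is asked (D-0152).

References: [CoatesSujatha2005] Conj. A, Thm. 3.4; [Lim2017FineSelmer] §3 Thm. 3.5, Lemma 3.2; [LimSujatha2018] §3 Prop. 3.2;
[Kida1982JFields] (μ-part, shape); [Iwasawa1973MuInvariants] Thm. 2/3; [Washington1997] §13.3; [SilvermanAEC2009] III.§1–2, III.6.4, VIII.§1;
[DokchitserDokchitserMathZ2012] Theorem (1), proof; [Kato2004Asterisque] Conj. 12.10 (p. 224); tree p718233 (w2 GEN 6), p734295 (w2 GEN 8),
p732124/p733022 (this seat GEN 9), `…TwoTorsionGaloisActionProofs`, `…FineRoadDivisionCubic` (att-p5).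
-/

set_option autoImplicit false
-- the Theorems namespace of this sub repeats the summit name by design (D-0017 nested layout)
set_option linter.dupNamespace false

noncomputable section

open scoped Classical NumberField Polynomial IntermediateField
open NumberField Field Polynomial IntermediateField

namespace Summit.BirchSwinnertonDyer.BirchSwinnertonDyer.Theorems.AddKatoTwo

open WeierstrassCurve Literature.NumberTheory.EllipticCurves Literature.NumberTheory.EllipticCurves.ZpExtension
  Literature.NumberTheory.GaloisRepresentations Literature.NumberTheory.IwasawaTheory Literature.NumberTheory.NumberFields
  Literature.NumberTheory.EllipticCurves.Rank1Residual
  Literature.NumberTheory.EllipticCurves.DokchitserDokchitser2012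
  Summit.BirchSwinnertonDyer.BirchSwinnertonDyer.Theorems.AlignedTransportAtTwoFineRoad
  Summit.BirchSwinnertonDyer.BirchSwinnertonDyer.Theorems.AlignedTransportAtTwoTorsionPointField
  Summit.BirchSwinnertonDyer.BirchSwinnertonDyer.Theorems.SteinbergFibreAtTwo

/-! ## §1 The point field of a `2`-torsion point is the cubic field of its abscissa — every model, every field of characteristic `0` -/

section PointField

universe u

variable {K : Type u} [Field K] (W : WeierstrassCurve K) [W.IsElliptic]

/-- **`σ` fixes the point `Tᵢ` of order `2` iff it fixes its abscissa `x(Tᵢ)`** (`σTᵢ = T_{σ(i)}`, `σx(Tᵢ) = x(T_{σ(i)})`, and both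
`i ↦ Tᵢ`, `i ↦ x(Tᵢ)` are injective). [cite: SilvermanAEC2009, III.2.3 and VIII.§1] [cite: DokchitserDokchitserMathZ2012, Theorem (1), proof] -/
theorem smul_T_eq_iff_smul_xT_eq (h2 : (2 : K) ≠ 0) (σ : absoluteGaloisGroup K) (i : Fin 3) :
    σ • T W h2 i = T W h2 i ↔ σ • xT W h2 i = xT W h2 i := by
  rw [← T_permGal, smul_xT, (T_injective W h2).eq_iff, (xT_injective W h2).eq_iff]

/-- **`Stab_{Γ_K}(Tᵢ) = Stab_{Γ_K}(x(Tᵢ))`.** [cite: SilvermanAEC2009, III.2.3 and VIII.§1] -/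
theorem stabilizer_T_eq_stabilizer_xT (h2 : (2 : K) ≠ 0) (i : Fin 3) :
    MulAction.stabilizer (absoluteGaloisGroup K) (T W h2 i) = MulAction.stabilizer (absoluteGaloisGroup K) (xT W h2 i) := by
  ext σ
  rw [MulAction.mem_stabilizer_iff, MulAction.mem_stabilizer_iff, smul_T_eq_iff_smul_xT_eq]

/-- **Every root `β ∈ K̄` of the `2`-division cubic `4x³ + b₂x² + 2b₄x + b₆` is the abscissa of a point `P ∈ W[2] ∖ 0` with
`Stab(P) = Stab(β)`** (the root set is `{x(T₀), x(T₁), x(T₂)}`, att-p5 `DivisionCubic.range_xT_eq_rootSet`).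
[cite: SilvermanAEC2009, Ex. III.3.7 (d) and VIII.§1] [cite: DokchitserDokchitserMathZ2012, Theorem (1), proof] -/
theorem exists_geomTorsion_two_ne_zero_stabilizer_eq (h2 : (2 : K) ≠ 0) {β : AlgebraicClosure K}
    (hβ : β ∈ W.twoTorsionPolynomial.toPoly.rootSet (AlgebraicClosure K)) :
    ∃ P : W.geomTorsion 2, P ≠ 0 ∧
      MulAction.stabilizer (absoluteGaloisGroup K) P = MulAction.stabilizer (absoluteGaloisGroup K) β := by
  rw [← DivisionCubic.range_xT_eq_rootSet W h2] at hβ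
  obtain ⟨i, rfl⟩ := hβ
  exact ⟨T W h2 i, fun h ↦ coe_T_ne_zero W h2 i (by rw [h]; rfl), stabilizer_T_eq_stabilizer_xT W h2 i⟩

/-- **Conversely every `P ∈ W[2] ∖ 0` has `Stab(P) = Stab(β)` for some root `β` of the `2`-division cubic** (namely `β = x(P)`).
[cite: SilvermanAEC2009, Ex. III.3.7 (d) and VIII.§1] -/
theorem exists_mem_rootSet_stabilizer_eq (h2 : (2 : K) ≠ 0) {P : W.geomTorsion 2} (hP : P ≠ 0) :
    ∃ β ∈ W.twoTorsionPolynomial.toPoly.rootSet (AlgebraicClosure K),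
      MulAction.stabilizer (absoluteGaloisGroup K) P = MulAction.stabilizer (absoluteGaloisGroup K) β := by
  rcases eq_zero_or_eq_T W h2 P with h | ⟨i, rfl⟩
  · exact absurd h hP
  · exact ⟨xT W h2 i, by rw [← DivisionCubic.range_xT_eq_rootSet W h2]; exact ⟨i, rfl⟩,
      stabilizer_T_eq_stabilizer_xT W h2 i⟩

variable [CharZero K]

/-- **THE POINT FIELD OF A `2`-TORSION POINT IS THE CUBIC FIELD OF ITS ABSCISSA — every model.** For every elliptic curve `W` over a
field `K` of characteristic `0` and every root `β ∈ K̄` of the `2`-division cubic `4x³ + b₂x² + 2b₄x + b₆` there is a point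
`P ∈ W[2] ∖ 0` (the point `(β, −(a₁β + a₃)/2)`) whose point field `K̄^{Stab P}` IS `K(β)` (Krull correspondence, k4's
`fixedField_stabilizer_eq_adjoin`). The cubic-model case is k4's `fixedField_stabilizer_eq_adjoin_root`.
[cite: SilvermanAEC2009, III.§1, III.2.3 and VIII.§1 (K(E[m]))] -/
theorem exists_geomTorsion_two_ne_zero_fixedField_stabilizer_eq_adjoin {β : AlgebraicClosure K}
    (hβ : aeval β W.twoTorsionPolynomial.toPoly = 0) :
    ∃ P : W.geomTorsion 2, P ≠ 0 ∧
      IntermediateField.fixedField (MulAction.stabilizer (absoluteGaloisGroup K) P) =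
        IntermediateField.adjoin K ({β} : Set (AlgebraicClosure K)) := by
  have h2 : (2 : K) ≠ 0 := two_ne_zero
  have hβ' : β ∈ W.twoTorsionPolynomial.toPoly.rootSet (AlgebraicClosure K) :=
    Polynomial.mem_rootSet.mpr ⟨DivisionCubic.twoTorsionPolynomial_toPoly_ne_zero W h2, hβ⟩
  obtain ⟨P, hP, hst⟩ := exists_geomTorsion_two_ne_zero_stabilizer_eq W h2 hβ'
  exact ⟨P, hP, by rw [hst, fixedField_stabilizer_eq_adjoin]⟩

/-- **Every `2`-torsion point field is a cubic field `K(β)`, `β` a root of the `2`-division cubic.**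
[cite: SilvermanAEC2009, III.§1, III.2.3 and VIII.§1 (K(E[m]))] -/
theorem exists_root_fixedField_stabilizer_eq_adjoin {P : W.geomTorsion 2} (hP : P ≠ 0) :
    ∃ β : AlgebraicClosure K, aeval β W.twoTorsionPolynomial.toPoly = 0 ∧
      IntermediateField.fixedField (MulAction.stabilizer (absoluteGaloisGroup K) P) =
        IntermediateField.adjoin K ({β} : Set (AlgebraicClosure K)) := by
  obtain ⟨β, hβ, hst⟩ := exists_mem_rootSet_stabilizer_eq W two_ne_zero hP
  exact ⟨β, (Polynomial.mem_rootSet.mp hβ).2, by rw [hst, fixedField_stabilizer_eq_adjoin]⟩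

/-- **`[K(β) : K] = 3` for a root `β` of the `2`-division cubic of a curve with irreducible `W[2]`** (the point field has degree `3`,
`finrank_fixedField_stabilizer_eq_three_of_irreducible`). [cite: SilvermanAEC2009, III.§1 and VIII.§1] -/
theorem finrank_adjoin_root_twoTorsionPolynomial_eq_three (hirr : W.HasIrreducibleModPGaloisRep 2) {β : AlgebraicClosure K}
    (hβ : aeval β W.twoTorsionPolynomial.toPoly = 0) :
    Module.finrank K (IntermediateField.adjoin K ({β} : Set (AlgebraicClosure K))) = 3 := by
  obtain ⟨P, hP, hF⟩ := exists_geomTorsion_two_ne_zero_fixedField_stabilizer_eq_adjoin W hβ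
  rw [← hF]
  exact finrank_fixedField_stabilizer_eq_three_of_irreducible W hirr hP

end PointField

/-! ## §2 Two SIGN-FREE general-model doors into statement (A) at `(W, 2)` -/

section Doors

variable (W : WeierstrassCurve ℚ) [W.IsElliptic]

/-- **(A)₂(W) from `μ₂ = 0` of the sextic `ℚ(β, √−1)` — every model, every sign of `Δ`.** `W/ℚ` elliptic, `β ∈ ℚ̄` a root of the
`2`-division cubic, `i² = −1`: if every cyclotomic `ℤ₂`-extension of `ℚ⟮β⟯ ⊔ ℚ⟮i⟯` has classical `μ = 0`, then for every cyclotomic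
`ℤ₂`-extension `κ` of `ℚ` some fine Selmer dual datum of `W` over `ℚ_∞` is finitely generated over `ℤ₂` (statement (A) at `(W, 2)`,
`∃ γ D` kernel form). §1 + w2 GEN 6's KERNEL sextic door `PointFieldMu.exists_fineSelmerDualData_moduleFinite_of_classicalMu_pointField_adjoin`
(carrier `ℚ(P) ⊔ ℚ⟮i⟯`, unipotent dévissage + Lim 3.5 at `2` upstairs). [cite: CoatesSujatha2005, Conj. A and Thm. 3.4]
[cite: Lim2017FineSelmer, §3 Thm. 3.5 and Lemma 3.2] [cite: Iwasawa1973MuInvariants, §1 (shape only)] -/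
theorem conjA_two_of_classicalMu_cubicField_adjoin_I {β : AlgebraicClosure ℚ} (hβ : aeval β W.twoTorsionPolynomial.toPoly = 0)
    {i : AlgebraicClosure ℚ} (hi : i ^ 2 = -1)
    (hμ : ∀ κF : ZpExtension ↥(IntermediateField.adjoin ℚ ({β} : Set (AlgebraicClosure ℚ)) ⊔
        IntermediateField.adjoin ℚ ({i} : Set (AlgebraicClosure ℚ))) 2, κF.IsCyclotomic → ClassicalMuVanishes κF)
    (κ : ZpExtension ℚ 2) (hκ : κ.IsCyclotomic) :
    ∃ (γ : absoluteGaloisGroup ℚ) (D : W.FineSelmerDualData κ γ),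
      Module.Finite ℤ_[2] (RestrictScalars ℤ_[2] (IwasawaAlgebra 2) D.X) := by
  obtain ⟨P, hP, hF⟩ := exists_geomTorsion_two_ne_zero_fixedField_stabilizer_eq_adjoin W hβ
  refine PointFieldMu.exists_fineSelmerDualData_moduleFinite_of_classicalMu_pointField_adjoin W hP hi ?_ κ hκ
  rw [hF]
  exact hμ

/-- **(A)₂(W) from NARROW `μ₂ = 0` of the cubic field `ℚ(β)` — every model, every sign of `Δ`.** `W/ℚ` elliptic with IRREDUCIBLE `W[2]`,
`β ∈ ℚ̄` a root of the `2`-division cubic (so `[ℚ(β) : ℚ] = 3`): if every cyclotomic `ℤ₂`-extension `κP` of `ℚ⟮β⟯` has (a) classical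
`μ = 0` and (b) bounded narrow defect `ord₂ h⁺(ℚ(β)_n) ≤ ord₂ h(ℚ(β)_n) + D` along its layers, then statement (A) at `(W, 2)` holds. The
first door after w2 GEN 8's Kida-lite ascent `classicalMu_sup_adjoin_of_sq_eq_neg_one_of_narrowDefect_le` (`μ₂(ℚ(β) ⊔ ℚ⟮i⟯) = 0`; its
cubic-model twin is w2's `NarrowMu.conjA_two_cubicModel_of_narrowMu`). On `Δ < 0` GEN 9's `conjA_two_of_classicalMu_cubicField_of_Δ_neg`
needs (a) only; on `0 < Δ` (`ℚ(β)` totally real) this is the cubic-field door. [cite: CoatesSujatha2005, Conj. A and Thm. 3.4]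
[cite: Kida1982JFields, main theorem (μ-part; shape only)] [cite: Iwasawa1973MuInvariants, Thm. 2 and Thm. 3] [cite: Washington1997, §13.3 Prop. 13.23] -/
theorem conjA_two_of_narrowMu_cubicField (hirr : W.HasIrreducibleModPGaloisRep 2)
    {β : AlgebraicClosure ℚ} (hβ : aeval β W.twoTorsionPolynomial.toPoly = 0)
    (hμ : ∀ κP : ZpExtension ↥(IntermediateField.adjoin ℚ ({β} : Set (AlgebraicClosure ℚ))) 2,
      κP.IsCyclotomic → ClassicalMuVanishes κP) (D : ℕ)
    (hδ : ∀ κP : ZpExtension ↥(IntermediateField.adjoin ℚ ({β} : Set (AlgebraicClosure ℚ))) 2, κP.IsCyclotomic → ∀ n : ℕ,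
      ∀ [NumberField ↥(κP.layer n)],
      padicValNat 2 (narrowClassNumber ↥(κP.layer n)) ≤ padicValNat 2 (classNumber ↥(κP.layer n)) + D)
    (κ : ZpExtension ℚ 2) (hκ : κ.IsCyclotomic) :
    ∃ (γ : absoluteGaloisGroup ℚ) (Dd : W.FineSelmerDualData κ γ),
      Module.Finite ℤ_[2] (RestrictScalars ℤ_[2] (IwasawaAlgebra 2) Dd.X) := by
  obtain ⟨i, hi⟩ := IsAlgClosed.exists_pow_nat_eq (-1 : AlgebraicClosure ℚ) two_pos
  haveI : FiniteDimensional ℚ ↥(IntermediateField.adjoin ℚ ({β} : Set (AlgebraicClosure ℚ))) :=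
    IntermediateField.adjoin.finiteDimensional ((AlgebraicClosure.isAlgebraic ℚ).isAlgebraic β).isIntegral
  -- (the `ℚ`-algebra structure on `ℚ̄` found here and the one of the generic §1 lemma are defeq, not syntactically equal: state
  -- the degree in the present currency first, then rewrite)
  have h3 : Module.finrank ℚ ↥(IntermediateField.adjoin ℚ ({β} : Set (AlgebraicClosure ℚ))) = 3 :=
    finrank_adjoin_root_twoTorsionPolynomial_eq_three W hirr hβ
  have hodd : Odd (Module.finrank ℚ ↥(IntermediateField.adjoin ℚ ({β} : Set (AlgebraicClosure ℚ)))) := by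
    rw [h3]; decide
  exact conjA_two_of_classicalMu_cubicField_adjoin_I W hβ hi
    (classicalMu_sup_adjoin_of_sq_eq_neg_one_of_narrowDefect_le _ hodd hi hμ D hδ) κ hκ

end Doors

/-! ## §3 v11's binder (I1M′) `hAnaMI`: a SIGN-FREE re-keying, and the `0 < Δ` half from narrow `μ₂ = 0` of the totally real cubic -/

/-- **The `2`-division cubic has a root in `ℚ̄`** (it is a genuine cubic, `4 ≠ 0`). [cite: SilvermanAEC2009, III.§1 and Ex. III.3.7 (d)] -/
theorem exists_aeval_twoTorsionPolynomial_eq_zero (W : WeierstrassCurve ℚ) :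
    ∃ β : AlgebraicClosure ℚ, aeval β W.twoTorsionPolynomial.toPoly = 0 := by
  have hdeg : W.twoTorsionPolynomial.toPoly.degree ≠ 0 := by
    rw [Cubic.degree_of_a_ne_zero (by change (4 : ℚ) ≠ 0; norm_num)]; decide
  exact IsAlgClosed.exists_aeval_eq_zero_of_injective (AlgebraicClosure ℚ) (algebraMap ℚ (AlgebraicClosure ℚ)).injective
    W.twoTorsionPolynomial.toPoly hdeg

/-- **v11's binder (I1M′) `hAnaMI` VERBATIM from ONE sign-free number-field statement on the sextics `ℚ(x(T), √−1)`.** If for every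
globally minimal, non-CM, analytic-rank-`0` curve `W`, additive and potentially multiplicative at `2` with irreducible `W[2]`, every root `β`
of its `2`-division cubic and every `i` with `i² = −1`, the cyclotomic `ℤ₂`-extensions of `ℚ⟮β⟯ ⊔ ℚ⟮i⟯` have classical `μ = 0`, then the
hypothesis `hAnaMI` of `additiveRankZeroAtTwo_of_residual_v11` holds (its type is the conclusion; the non-abelian guard is not needed).
350 classes of the census (269 with `Δ < 0`, 81 with `0 < Δ`); OPEN, nothing asserted. [cite: CoatesSujatha2005, Conj. A and Thm. 3.4]
[cite: Kato2004Asterisque, Conj. 12.10 (p. 224)] [cite: Lim2017FineSelmer, §3 Thm. 3.5 and Lemma 3.2] -/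
theorem hAnaMI_of_cubicFieldAdjoinIMu
    (hμ6 : ∀ (W : WeierstrassCurve ℚ) [W.IsElliptic] [W.IsGloballyMinimal], ¬ W.HasCM → W.analyticRank = 0 →
      Addv W 2 → padicValRat 2 W.j < 0 → W.HasIrreducibleModPGaloisRep 2 →
      ∀ β : AlgebraicClosure ℚ, aeval β W.twoTorsionPolynomial.toPoly = 0 →
      ∀ i : AlgebraicClosure ℚ, i ^ 2 = -1 →
      ∀ κF : ZpExtension ↥(IntermediateField.adjoin ℚ ({β} : Set (AlgebraicClosure ℚ)) ⊔
          IntermediateField.adjoin ℚ ({i} : Set (AlgebraicClosure ℚ))) 2, κF.IsCyclotomic → ClassicalMuVanishes κF) :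
    ∀ (W : WeierstrassCurve ℚ) [W.IsElliptic] [W.IsGloballyMinimal], ¬ W.HasCM → W.analyticRank = 0 →
      Addv W 2 → padicValRat 2 W.j < 0 → W.HasIrreducibleModPGaloisRep 2 → ¬ IsAbelianGalois ℚ (W.divisionField 2) →
      ∀ (κ : ZpExtension ℚ 2), κ.IsCyclotomic →
        ∃ (γ : Field.absoluteGaloisGroup ℚ) (D : W.FineSelmerDualData κ γ),
          Module.Finite ℤ_[2] (RestrictScalars ℤ_[2] (IwasawaAlgebra 2) D.X) := by
  intro W _ _ hcm hr hadd hj hirr _ κ hκ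
  obtain ⟨β, hβ⟩ := exists_aeval_twoTorsionPolynomial_eq_zero W
  obtain ⟨i, hi⟩ := IsAlgClosed.exists_pow_nat_eq (-1 : AlgebraicClosure ℚ) two_pos
  exact conjA_two_of_classicalMu_cubicField_adjoin_I W hβ hi (hμ6 W hcm hr hadd hj hirr β hβ i hi) κ hκ

/-- **v11's binder (I1M′) `hAnaMI` VERBATIM from NARROW `μ₂ = 0` of the cubic fields `ℚ(x(T))`, sign-free**: (a) classical `μ = 0` and
(b) bounded narrow defect along the cyclotomic `ℤ₂`-tower of `ℚ⟮β⟯`, for every irreducible additive pot-mult `W` as above and every root `β`,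
imply `hAnaMI`. On `Δ < 0` this asks more than GEN 9's (a)-only door; see `hAnaMI_of_cubicFieldMu_of_cubicFieldNarrowMu` for the sharp split.
OPEN, nothing asserted. [cite: CoatesSujatha2005, Conj. A and Thm. 3.4] [cite: Kida1982JFields, main theorem (μ-part; shape only)]
[cite: Kato2004Asterisque, Conj. 12.10 (p. 224)] -/
theorem hAnaMI_of_cubicFieldNarrowMu
    (hμ3n : ∀ (W : WeierstrassCurve ℚ) [W.IsElliptic] [W.IsGloballyMinimal], ¬ W.HasCM → W.analyticRank = 0 →
      Addv W 2 → padicValRat 2 W.j < 0 → W.HasIrreducibleModPGaloisRep 2 →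
      ∀ β : AlgebraicClosure ℚ, aeval β W.twoTorsionPolynomial.toPoly = 0 →
      (∀ κP : ZpExtension ↥(IntermediateField.adjoin ℚ ({β} : Set (AlgebraicClosure ℚ))) 2,
          κP.IsCyclotomic → ClassicalMuVanishes κP) ∧
      ∃ D : ℕ, ∀ κP : ZpExtension ↥(IntermediateField.adjoin ℚ ({β} : Set (AlgebraicClosure ℚ))) 2, κP.IsCyclotomic → ∀ n : ℕ,
        ∀ [NumberField ↥(κP.layer n)],
        padicValNat 2 (narrowClassNumber ↥(κP.layer n)) ≤ padicValNat 2 (classNumber ↥(κP.layer n)) + D) :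
    ∀ (W : WeierstrassCurve ℚ) [W.IsElliptic] [W.IsGloballyMinimal], ¬ W.HasCM → W.analyticRank = 0 →
      Addv W 2 → padicValRat 2 W.j < 0 → W.HasIrreducibleModPGaloisRep 2 → ¬ IsAbelianGalois ℚ (W.divisionField 2) →
      ∀ (κ : ZpExtension ℚ 2), κ.IsCyclotomic →
        ∃ (γ : Field.absoluteGaloisGroup ℚ) (D : W.FineSelmerDualData κ γ),
          Module.Finite ℤ_[2] (RestrictScalars ℤ_[2] (IwasawaAlgebra 2) D.X) := by
  intro W _ _ hcm hr hadd hj hirr _ κ hκ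
  obtain ⟨β, hβ⟩ := exists_aeval_twoTorsionPolynomial_eq_zero W
  obtain ⟨hμ, D, hδ⟩ := hμ3n W hcm hr hadd hj hirr β hβ
  exact conjA_two_of_narrowMu_cubicField W hirr hβ hμ D hδ κ hκ

/-- **The `0 < Δ` half of (I1M′) — GEN 9's displayed `hPos` — from NARROW `μ₂ = 0` of the TOTALLY REAL cubic `ℚ(x(T))`.** If for every
globally minimal, non-CM, analytic-rank-`0`, additive pot-mult `W` with irreducible `W[2]` and `0 < Δ(W)` (three real roots: `ℚ(x(T))` totally
real, `ℚ(E[2])` totally real — the half GEN 9 left displayed) and every root `β`, the cubic field `ℚ⟮β⟯` has (a) classical `μ₂ = 0` and (b)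
bounded narrow defect along its cyclotomic `ℤ₂`-tower, then the `hPos` hypothesis of `hAnaMI_of_cubicFieldMu_of_posDisc` holds (81 classes of
the census). Greenberg-conjecture territory for non-abelian totally real cubics — OPEN, nothing asserted.
[cite: CoatesSujatha2005, Conj. A and Thm. 3.4] [cite: Kida1982JFields, main theorem (μ-part; shape only)] [cite: Washington1997, §13.3 Prop. 13.23] -/
theorem hAnaMI_posDisc_of_cubicFieldNarrowMu
    (hμ3p : ∀ (W : WeierstrassCurve ℚ) [W.IsElliptic] [W.IsGloballyMinimal], ¬ W.HasCM → W.analyticRank = 0 →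
      Addv W 2 → padicValRat 2 W.j < 0 → W.HasIrreducibleModPGaloisRep 2 → 0 < W.Δ →
      ∀ β : AlgebraicClosure ℚ, aeval β W.twoTorsionPolynomial.toPoly = 0 →
      (∀ κP : ZpExtension ↥(IntermediateField.adjoin ℚ ({β} : Set (AlgebraicClosure ℚ))) 2,
          κP.IsCyclotomic → ClassicalMuVanishes κP) ∧
      ∃ D : ℕ, ∀ κP : ZpExtension ↥(IntermediateField.adjoin ℚ ({β} : Set (AlgebraicClosure ℚ))) 2, κP.IsCyclotomic → ∀ n : ℕ,
        ∀ [NumberField ↥(κP.layer n)],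
        padicValNat 2 (narrowClassNumber ↥(κP.layer n)) ≤ padicValNat 2 (classNumber ↥(κP.layer n)) + D) :
    ∀ (W : WeierstrassCurve ℚ) [W.IsElliptic] [W.IsGloballyMinimal], ¬ W.HasCM → W.analyticRank = 0 →
      Addv W 2 → padicValRat 2 W.j < 0 → W.HasIrreducibleModPGaloisRep 2 → ¬ IsAbelianGalois ℚ (W.divisionField 2) → 0 < W.Δ →
      ∀ (κ : ZpExtension ℚ 2), κ.IsCyclotomic →
        ∃ (γ : Field.absoluteGaloisGroup ℚ) (D : W.FineSelmerDualData κ γ),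
          Module.Finite ℤ_[2] (RestrictScalars ℤ_[2] (IwasawaAlgebra 2) D.X) := by
  intro W _ _ hcm hr hadd hj hirr _ hΔ κ hκ
  obtain ⟨β, hβ⟩ := exists_aeval_twoTorsionPolynomial_eq_zero W
  obtain ⟨hμ, D, hδ⟩ := hμ3p W hcm hr hadd hj hirr hΔ β hβ
  exact conjA_two_of_narrowMu_cubicField W hirr hβ hμ D hδ κ hκ

end Summit.BirchSwinnertonDyer.BirchSwinnertonDyer.Theorems.AddKatoTwo

end
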